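import Literature.Computability.Complexity.NPEqUnionNTIME
import HarnessLib

/-!
# Unambiguous nondeterministic time: `UTIME t`, `coUTIME t`, and `UP = ⋃ₖ UTIME(nᵏ)`

Literature / complexity toolkit, companion of `Nondeterministic.lean` (`NTIME`, `UP`) and
`NPEqUnionNTIME.lean` (`NP = ⋃ₖ NTIME(nᵏ)`).

Valiant (1976) introduced the class `UP` of languages accepted by polynomial-time
nondeterministic Turing machines with AT MOST ONE accepting computation on every input; the tree's
`UP` (`Nondeterministic.lean`) is its verifier form: an `NP` presentation `(L' ∈ P, p)` whose set
of accepted witnesses `{y | |y| ≤ p |x| ∧ ⟨x, y⟩ ∈ L'}` is `Set.Subsingleton` for every `x`.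
The time-bounded classes `UTIME(t)` ("unambiguous time `t`": languages accepted by
`O(t)`-time-bounded nondeterministic machines with at most one accepting computation per input;
`UP = ⋃ₖ UTIME(nᵏ)`) are standard — Hemaspaandra–Rothe, *Unambiguous computation: Boolean
hierarchies and sparse Turing-complete sets*, SIAM J. Comput. 26 (1997), §1–2; Fortnow–Santhanam–
Trevisan, *Hierarchies for semantic classes*, STOC 2005, §1 (UTIME among the semantic classes);
Naik–Regan–Sivakumar, *On quasilinear-time complexity theory*, TCS 148 (1995), Def. 2.2 (`UQL`).

This file defines them over the tree's model, as the EXACT MIRROR of `NTIME t`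
(one constant `c` bounds the admissible witnesses `|y| ≤ c · t |x| + c` and the running time of a
`TM2` verifier machine on admissible pairs) plus Valiant's clause: for every input `x` the set of
admissible accepted witnesses is `Set.Subsingleton`.

* `UTIME t`, `coUTIME t := co (UTIME t)`;
* `UTIME_subset_NTIME` (forget uniqueness), `coUTIME_subset_coNTIME`;
* `exists_mem_P_pairLanguage_of_verifier` — the machine content of Arora–Barak Thm. 2.6 (⊇) in a
  form recording the admissible witnesses POINTWISE (a strengthening of
  `exists_mem_P_verifier_of_mem_NTIME_pow` of `NPEqUnionNTIME.lean`, same construction);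
* `UP_subset_iUnion_UTIME`, `UTIME_pow_subset_UP`, `iUnion_UTIME_subset_UP`, and
  **`UP_eq_iUnion_UTIME : UP = ⋃ₖ UTIME(nᵏ)`** — the unambiguous twin of `NP_eq_iUnion_NTIME_holds`
  (Hemaspaandra–Rothe 1997 §2 take this as the definition of `UP` from `UTIME`; here it is a
  theorem relating the two verifier forms: truncating an over-long witness and re-checking its
  length preserves the witness set, hence its being subsingleton).

Design notes.
* "Unambiguous" is a property of the PRESENTATION `(c, R, M)`, quantified existentially inside the
  same existential as the time bound (exactly as in `UP`): a fast ambiguous verifier and a slow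
  unambiguous one must not combine.
* Machine form vs verifier form. For `t n ≥ n` time-constructible, a `t`-time nondeterministic
  multitape machine with at most one accepting computation per input yields a verifier of this
  shape whose witnesses are the transcripts of nondeterministic choices, PROVIDED the verifier
  rejects choice strings that are longer than the computation they drive or otherwise not a valid
  transcript (otherwise one accepting computation would have many accepted paddings and the
  `Subsingleton` clause would fail for a spurious reason); conversely guess-and-verify. This
  standard equivalence is recorded here, not formalised (the tree models nondeterminism by
  certificates only, `Nondeterministic.lean` design notes).
* Deliberately NOT here: `DTIME t ⊆ UTIME t` (needs a linear-time verifier testing `y = ε`, cf.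
  `P_subset_UP` in `QuantumComplexity/FactoringUP.lean` at the polynomial level), monotonicity in
  `t`, closure under deterministic many-one reductions, padding / translation lemmas, and every
  separation question (`NTIME(n) ⊄ UTIME(n)`, `NP ≠ UP` are open problems and live in route files).

## References

* L. G. Valiant, *Relative complexity of checking and evaluating*, Inform. Process. Lett. 5 (1976)
  20–23 (the class `UP`).
* L. A. Hemaspaandra, J. Rothe, *Unambiguous computation: Boolean hierarchies and sparse
  Turing-complete sets*, SIAM J. Comput. 26(3) (1997) 634–653, §1–2 (`UP`, unambiguous time classes,
  "it is an open question whether unambiguous computation has nontrivial time hierarchy theorems").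
* L. Fortnow, R. Santhanam, L. Trevisan, *Hierarchies for semantic classes*, STOC 2005 (UTIME).
* S. Arora, B. Barak, *Computational Complexity: A Modern Approach*, CUP 2009, Def. 2.1, Thm. 2.6
  (verifier form of nondeterministic time; `NP = ⋃ NTIME(n^c)`), Def. 9.14 / Ex. 9 (UP).
-/

namespace Literature.Computability.Complexity

open _root_.Computability Turing Polynomial Brick Plumb PairFstTM

/-! ### The classes -/

/-- `UTIME t`: languages decidable in UNAMBIGUOUS nondeterministic time `O(t n)`, in verifier form
(the exact mirror of `NTIME t` plus Valiant's uniqueness clause).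
`L ∈ UTIME t` iff there are `c : ℕ`, a Boolean relation `R` and a TM2 machine `M` such that
(i) for all `x` and all witnesses `y` with `|y| ≤ c * t |x| + c`, `M` on input `boolPair x y`
outputs `encodeBool (R x y)` within `c * t |x| + c` steps,
(ii) `x ∈ L ↔ ∃ y, |y| ≤ c * t |x| + c ∧ R x y = true`, and
(iii) for every `x` the set `{y | |y| ≤ c * t |x| + c ∧ R x y = true}` of admissible accepted
witnesses has at most one element (`Set.Subsingleton`).
For `t n ≥ n` this is the class of languages accepted by `O(t)`-time nondeterministic multitape
machines with at most one accepting computation on every input (guess-and-verify; the verifier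
rejects ill-formed or over-long choice transcripts). `UP = ⋃ₖ UTIME(nᵏ)` is `UP_eq_iUnion_UTIME`.
[Valiant 1976; Hemaspaandra–Rothe 1997, §2; Arora–Barak 2009, Def. 2.1 / Def. 9.14]
[cite: Valiant1976] -/
def UTIME (t : ℕ → ℕ) : Set (Language Bool) :=
  {L | ∃ (c : ℕ) (R : List Bool → List Bool → Bool) (M : TM2ComputableAux Bool Bool),
    (∀ x y : List Bool, y.length ≤ c * t x.length + c →
      M.OutputsWithin (boolPair x y) (encodeBool (R x y)) (c * t x.length + c)) ∧
    (∀ x : List Bool, x ∈ L ↔ ∃ y : List Bool, y.length ≤ c * t x.length + c ∧ R x y = true) ∧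
    ∀ x : List Bool, {y : List Bool | y.length ≤ c * t x.length + c ∧ R x y = true}.Subsingleton}

/-- `coUTIME t = co (UTIME t)`: complements of unambiguous-time-`t` languages.
[Valiant 1976; Hemaspaandra–Rothe 1997, §2] [cite: Valiant1976] -/
def coUTIME (t : ℕ → ℕ) : Set (Language Bool) :=
  co (UTIME t)

/-! ### API: forgetting uniqueness -/

/-- `UTIME t ⊆ NTIME t` (forget the uniqueness clause; same constant, relation and machine).
[Valiant 1976: `UP ⊆ NP`; Hemaspaandra–Rothe 1997, §2] [cite: Valiant1976] -/
theorem UTIME_subset_NTIME (t : ℕ → ℕ) : UTIME t ⊆ NTIME t := by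
  rintro L ⟨c, R, M, hM, hL, -⟩
  exact ⟨c, R, M, hM, hL⟩

/-- `coUTIME t ⊆ coNTIME t`. [Valiant 1976; Hemaspaandra–Rothe 1997, §2] [cite: Valiant1976] -/
theorem coUTIME_subset_coNTIME (t : ℕ → ℕ) : coUTIME t ⊆ coNTIME t :=
  co_mono (UTIME_subset_NTIME t)

/-- Unfolding `coUTIME`: `L ∈ coUTIME t ↔ Lᶜ ∈ UTIME t`. [cite: Valiant1976] -/
theorem mem_coUTIME_iff {t : ℕ → ℕ} {L : Language Bool} : L ∈ coUTIME t ↔ Lᶜ ∈ UTIME t :=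
  Iff.rfl

/-! ### `UP ⊆ ⋃ₖ UTIME(nᵏ)` -/

/-- **`UP ⊆ ⋃ₖ UTIME(nᵏ)`** — the unambiguous twin of `NP_subset_iUnion_NTIME` (Arora–Barak 2009,
Thm. 2.6 "⊆", read for Valiant's `UP`). Same verifier as there: on `⟨x, y⟩` truncate the witness
at `p(|x|) + 1` (`truncMapAux` behind the clock `x ↦ ⟨x, 1^{p(|x|)+1}⟩`), then decide
`LenLe p ⊓ L'` ("the kept witness is admissible and accepted"). A witness accepted by this
relation is NOT truncated (a truncated one has length `p(|x|) + 1` and fails `LenLe p`), so the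
accepted witnesses inside the `UTIME` range are exactly the `UP`-witnesses of `x` — a subsingleton.
[cite: Valiant1976] [cite: AroraBarak2009, Thm. 2.6] -/
theorem UP_subset_iUnion_UTIME : UP ⊆ ⋃ k : ℕ, UTIME (fun n => n ^ k) := by
  rintro L ⟨L', hL'P, p, hL, hU⟩
  -- a decider of `LenLe p ⊓ L'`
  have hL'' : LenLe p ⊓ L' ∈ Classes.P := inter_mem_P (LenLe_mem_P p) hL'P
  simp only [Classes.P, Set.mem_iUnion] at hL''
  obtain ⟨k, a, hdec⟩ := hL''
  obtain ⟨M, hM⟩ := (hdec : TimeDecidable id (LenLe p ⊓ L') fun n => a * n ^ k + a)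
  -- the clock and the dominating power
  obtain ⟨q, N, hN⟩ := exists_machine_pair_ones p
  obtain ⟨b, d, hb⟩ := exists_eval_le_mul_pow_add
    (q + 5 * X + 13 + 2 * (p + 1) + (C a * (2 * X + 3 + p) ^ k + C a))
  let V : TM2ComputableAux Bool Bool := (truncMapAux N).comp M
  have hind : ∀ w : List Bool, (LenLe p ⊓ L').boolIndicator w = true ↔ w ∈ LenLe p ∧ w ∈ L' :=
    fun w => (Set.mem_iff_boolIndicator ((LenLe p ⊓ L' : Language Bool) : Set (List Bool)) w).symm
  -- an accepted witness is an untruncated `UP`-witness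
  have hacc : ∀ x y : List Bool,
      (LenLe p ⊓ L').boolIndicator (boolPair x (y.take (p.eval x.length + 1))) = true →
        y.length ≤ p.eval x.length ∧ boolPair x y ∈ L' := by
    intro x y h
    rw [hind, boolPair_mem_LenLe] at h
    have hlen : y.length ≤ p.eval x.length := by
      by_contra hlt
      have : (y.take (p.eval x.length + 1)).length = p.eval x.length + 1 :=
        List.length_take_of_le (by omega)
      omega
    rw [List.take_of_length_le (by omega)] at h
    exact ⟨hlen, h.2⟩
  refine Set.mem_iUnion.2 ⟨d, 2 * b + 2,
    fun x y => (LenLe p ⊓ L').boolIndicator (boolPair x (y.take (p.eval x.length + 1))), V,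
    fun x y hy => ?_, fun x => ?_, fun x => ?_⟩
  · -- running time
    have h₁ := outputsWithin_truncMapAux_boolPair N (y := y) (hN x)
    simp only [List.length_replicate] at h₁
    set y' := y.take (p.eval x.length + 1) with hy'
    have hlen' : y'.length ≤ p.eval x.length + 1 := List.length_take_le _ _
    have h₂ : M.OutputsWithin (boolPair x y') (encodeBool ((LenLe p ⊓ L').boolIndicator
        (boolPair x y'))) (a * (2 * x.length + 3 + p.eval x.length) ^ k + a) := by
      refine (hM (boolPair x y')).mono ?_
      simp only [id, length_boolPair]
      have : 2 * x.length + 2 + y'.length ≤ 2 * x.length + 3 + p.eval x.length := by omega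
      exact Nat.add_le_add_right (Nat.mul_le_mul_left a (Nat.pow_le_pow_left this k)) a
    have h := Turing.TM2ComputableAux.comp_outputsWithin _ _ h₁ h₂
    refine h.mono ?_
    have hbn := hb x.length
    simp only [eval_add, eval_mul, eval_ofNat, eval_X, eval_pow, eval_C, eval_one] at hbn
    have hy2 : 2 * (y.length / 2) ≤ (2 * b + 2) * x.length ^ d + (2 * b + 2) :=
      (Nat.mul_div_le y.length 2).trans hy
    nlinarith [hbn, hy2]
  · -- correctness
    rw [hL x]
    constructor
    · rintro ⟨y₀, hy₀, hmem⟩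
      refine ⟨y₀, ?_, ?_⟩
      · have hbn := hb x.length
        simp only [eval_add, eval_mul, eval_ofNat, eval_X, eval_pow, eval_C, eval_one] at hbn
        show y₀.length ≤ (2 * b + 2) * x.length ^ d + (2 * b + 2)
        calc y₀.length ≤ p.eval x.length := hy₀
          _ ≤ b * x.length ^ d + b := by omega
          _ ≤ (2 * b + 2) * x.length ^ d + (2 * b + 2) :=
              Nat.add_le_add (Nat.mul_le_mul_right _ (by omega)) (by omega)
      · rw [hind, List.take_of_length_le (by omega), boolPair_mem_LenLe]
        exact ⟨hy₀, hmem⟩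
    · rintro ⟨y, -, hR⟩
      obtain ⟨hy, hmem⟩ := hacc x y hR
      exact ⟨y, hy, hmem⟩
  · -- uniqueness: accepted witnesses are `UP`-witnesses of `x`
    intro y₁ hy₁ y₂ hy₂
    exact hU x (hacc x y₁ hy₁.2) (hacc x y₂ hy₂.2)

/-! ### `UTIME(nᵏ) ⊆ UP` -/

/-- **Total polynomial-time decider of the admissible-pair relation** (the machine content of
Arora–Barak 2009, Thm. 2.6 "⊇", with the witness correspondence recorded POINTWISE). Given a
constant `c`, a relation `R₀` and a machine `M` computing `R₀ x y` on `⟨x, y⟩` within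
`c|x|ᵏ + c` steps for every ADMISSIBLE `y` (`|y| ≤ c|x|ᵏ + c`), the language of pairs
`L' = {z | R₀ x (r ↾ (c|x|ᵏ + c)) = true}` (`x = (boolUnpair z).1`, `r = readRest z`) is in `P`
— decided on EVERY word by `truncMapAux (clock x ↦ ⟨x, 1^{c|x|ᵏ+c}⟩) ⨟ M` — and for admissible
`y`, `⟨x, y⟩ ∈ L' ↔ R₀ x y = true`. (Same construction as
`exists_mem_P_verifier_of_mem_NTIME_pow`; the pointwise form is what transports the uniqueness
clause.) [cite: AroraBarak2009, Thm. 2.6] -/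
theorem exists_mem_P_pairLanguage_of_verifier {k c : ℕ} {R₀ : List Bool → List Bool → Bool}
    {M : TM2ComputableAux Bool Bool}
    (hM : ∀ x y : List Bool, y.length ≤ c * x.length ^ k + c →
      M.OutputsWithin (boolPair x y) (encodeBool (R₀ x y)) (c * x.length ^ k + c)) :
    ∃ L' : Language Bool, L' ∈ Classes.P ∧
      ∀ x y : List Bool, y.length ≤ c * x.length ^ k + c →
        (boolPair x y ∈ L' ↔ R₀ x y = true) := by
  obtain ⟨q, N, hN⟩ := exists_machine_pair_ones_mul_pow_add c k
  -- the total relation: cut what the pair reader leaves at the admissible length, then ask `R₀`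
  let R : List Bool → Bool := fun z =>
    R₀ (boolUnpair z).1 ((readRest z).take (c * (boolUnpair z).1.length ^ k + c))
  let L' : Language Bool := {z | R z = true}
  let V : TM2ComputableAux Bool Bool := (truncMapAux N).comp M
  -- the dominating power of the running time
  obtain ⟨a, d, ha⟩ := exists_eval_le_mul_pow_add
    (q + 3 * X + 2 * (C c * X ^ k + C c) + X + X + 9 + (C c * X ^ k + C c))
  refine ⟨L', ?_, fun x y hy => ?_⟩
  · -- `L' ∈ P`: `V` decides `L'` within `a |z|ᵈ + a` steps on every word `z`
    simp only [Classes.P, Set.mem_iUnion]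
    refine ⟨d, a, V, fun z => ?_⟩
    have hxz : (boolUnpair z).1.length ≤ z.length := length_boolUnpair_fst_le z
    have hr : (readRest z).length ≤ z.length := by
      have h1 := readSteps_add_le z
      have h2 := one_le_readSteps z
      omega
    have h₁ := outputsWithin_truncMapAux N (z := z) (hN (boolUnpair z).1)
    simp only [List.length_replicate] at h₁
    have hlen : ((readRest z).take (c * (boolUnpair z).1.length ^ k + c)).length ≤
        c * (boolUnpair z).1.length ^ k + c := List.length_take_le _ _
    have h₂ : M.OutputsWithin
        (boolPair (boolUnpair z).1 ((readRest z).take (c * (boolUnpair z).1.length ^ k + c)))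
        (encodeBool (R z)) (c * (boolUnpair z).1.length ^ k + c) := hM _ _ hlen
    have h := Turing.TM2ComputableAux.comp_outputsWithin _ _ h₁ h₂
    have hind : L'.boolIndicator z = R z := by
      rw [Bool.eq_iff_iff, ← Set.mem_iff_boolIndicator]
      exact Iff.rfl
    show V.OutputsWithin z (encodeBool (L'.boolIndicator z)) (a * z.length ^ d + a)
    rw [hind]
    refine h.mono ?_
    have haz := ha z.length
    simp only [eval_add, eval_mul, eval_ofNat, eval_X, eval_pow, eval_C] at haz
    have hq : q.eval (boolUnpair z).1.length ≤ q.eval z.length := TM2Iter.eval_mono q hxz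
    have hck : c * (boolUnpair z).1.length ^ k ≤ c * z.length ^ k :=
      Nat.mul_le_mul_left c (Nat.pow_le_pow_left hxz k)
    omega
  · -- the admissible witnesses are the same, pointwise
    show R (boolPair x y) = true ↔ R₀ x y = true
    simp only [R, boolUnpair_boolPair, readRest_boolPair, List.take_of_length_le hy]

/-- **`UTIME(nᵏ) ⊆ UP`** (Arora–Barak 2009, Thm. 2.6 "⊇", read for Valiant's `UP`): the pair
language `L' ∈ P` of `exists_mem_P_pairLanguage_of_verifier` with the witness polynomial
`c Xᵏ + c` has, for every `x`, exactly the admissible accepted witnesses of the `UTIME`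
presentation as its `UP`-witnesses; membership and uniqueness transfer verbatim.
[cite: Valiant1976] [cite: AroraBarak2009, Thm. 2.6] -/
theorem UTIME_pow_subset_UP (k : ℕ) : UTIME (fun n => n ^ k) ⊆ UP := by
  rintro L ⟨c, R₀, M, hM, hL, hU⟩
  obtain ⟨L', hL'P, hiff⟩ := exists_mem_P_pairLanguage_of_verifier (k := k) (c := c) hM
  have hev : ∀ x : List Bool, (C c * X ^ k + C c : Polynomial ℕ).eval x.length =
      c * x.length ^ k + c := fun x => by
    simp only [eval_add, eval_mul, eval_C, eval_pow, eval_X]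
  refine ⟨L', hL'P, C c * X ^ k + C c, fun x => ?_, fun x => ?_⟩
  · rw [hL x, hev x]
    exact exists_congr fun y => and_congr_right fun hy => (hiff x y hy).symm
  · rw [hev x]
    intro y₁ hy₁ y₂ hy₂
    exact hU x ⟨hy₁.1, (hiff x y₁ hy₁.1).1 hy₁.2⟩ ⟨hy₂.1, (hiff x y₂ hy₂.1).1 hy₂.2⟩

/-- **`⋃ₖ UTIME(nᵏ) ⊆ UP`.** [cite: Valiant1976] -/
theorem iUnion_UTIME_subset_UP : (⋃ k : ℕ, UTIME (fun n => n ^ k)) ⊆ UP :=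
  Set.iUnion_subset fun k => UTIME_pow_subset_UP k

/-- **`UP = ⋃ₖ UTIME(nᵏ)`**: Valiant's certificate class `UP` agrees with unambiguous polynomial
time defined from the time classes `UTIME` (Hemaspaandra–Rothe 1997, §2, where this union is the
definition of `UP`; Arora–Barak 2009, Thm. 2.6 for the `NP`/`NTIME` twin, `NP_eq_iUnion_NTIME_holds`).
[cite: Valiant1976] [cite: AroraBarak2009, Thm. 2.6] -/
theorem UP_eq_iUnion_UTIME : UP = ⋃ k : ℕ, UTIME (fun n => n ^ k) :=
  Set.Subset.antisymm UP_subset_iUnion_UTIME iUnion_UTIME_subset_UP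

end Literature.Computability.Complexity
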